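import Summits.ResolutionOfSingularities.ResolutionOfSingularities.Theorems.HomologicalConductorNoZenoChartFibreCurves
import Summits.ResolutionOfSingularities.ResolutionOfSingularities.Theorems.HomologicalConductorNoZenoChartGermResolution
import Summits.ResolutionOfSingularities.ResolutionOfSingularities.Theorems.HomologicalConductorNoZenoSplitDataThread
import Summits.ResolutionOfSingularities.ResolutionOfSingularities.Theorems.HomologicalConductorNoZenoL1CoreRational
import Summits.ResolutionOfSingularities.ResolutionOfSingularities.Theorems.SyzygyFlatteningHigherRankTerminationEssFiniteType
import Summits.ResolutionOfSingularities.ResolutionOfSingularities.Theorems.SyzygyFlatteningRankOneTerminationStageNormal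
import Literature.AlgebraicGeometry.Resolution.BlowupsFlatBaseChange
import HarnessLib

/-!
# Crux `NoZenoR` / `NoZeno` (stmt-ResolutionOfSingularities-19943 / -16483) — slot 5 (B1) closer: THE SEAM-1 PACKAGE in the literal
# `Sig.L1Core` binders (res-L0-w44-plan-1 DESK WORD 22 «GO `…NoZenoSeam1Package.lean`»)

Route `ResolutionOfSingularities/HomologicalConductor`, W4.4 chain, slot 5 `stub_L1wCoreF3`.  ONE ∃-theorem, `exists_seam1Package`, consuming
the binders of `Beta2Descent.Sig.L1Core HasSplitExcCurveCountLE IsSepX1Sandwiched` VERBATIM (`T P hP … C hCT hrad hS x hxC hx0 B hB 𝔮 h𝔮 D′ hD′ hEq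
hDD′ hdim′ hnorm′`, as in the lead's closer skeleton `L1wCoreCloser-SKELETON.lean` d2cae9e6707cd6ee) plus the two printed facts `Lipman1969_1_2`,
`Lipman1969_12_1_i`, and delivering the inputs `C / hCsub / hCconn / hCmiss / ψ / gW / hgC / hginj` of the lead's seam-2 theorem
`hasSplitExcCurveCountLE_pred_routeM` (res-L0-w44-lead-1 INTERFACE 21:13:10Z) in its spellings, together with the data the other suppliers
transfer along (`π` minimal, `ρ` the node blow-up, `IsResolution (ρ ≫ π)`, the local isomorphisms `gW.stalkMap`, the square
`gW ≫ ρ ≫ π = ψ ≫ Spec(D ⊆ D′)`, closures of the `C`-curves inside `range gW`).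

The proof is PURE GLUE over the landed pieces (1β) `exists_chartData_of_isSepX1Sandwiched` (p570053), `P ≠ ∅`
`exists_excCurveDegree_baseIdealDivisor_neg_of_hasRationalSingularity`, (G4) `ChartFibre.isMaximal_and_comap_eq_chart_ideal` (res-D-pv-039
p569474), (1α) `exists_chartGermResolution` (p566359) and (1γ) `…ChartFibreCurves` (p571909), crossing the two SPELLING BRIDGES inside:
(S1) `B = k[T_P ∪ C·x⁻¹] = k[T_P ∪ I·x⁻¹]` for `I = (C)·T_P` (`adjoin_locPrime_chart_set_eq`), (S2) `locPrime T P = SplittingBase.locPrimeSubalgebra T P`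
(same carrier, `rfl`).  Def-free, no new facts; `--supports 19943 --as helper`.  OURS (cell res-hironaka): AI-produced and kernel-checked,
weaker than expert review; nothing here is a statement of the manuscript under review (Hironaka 2017); counted 0.
-/

noncomputable section

-- single-problem summit: the doubled namespace component `ResolutionOfSingularities` is forced
set_option linter.dupNamespace false

open CategoryTheory CategoryTheory.Limits AlgebraicGeometry TopologicalSpace Opposite IsLocalRing
open Literature.AlgebraicGeometry Literature.AlgebraicGeometry.Resolution Literature.AlgebraicGeometry.Motives
open Summit.ResolutionOfSingularities.ResolutionOfSingularities.Theorems.NoZeno.Birth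
open Summit.ResolutionOfSingularities.ResolutionOfSingularities.Theorems.NoZeno.SandwichCluster
open Summit.ResolutionOfSingularities.ResolutionOfSingularities.Theorems.NoZeno.SandwichCluster.Parasite
  (locPrime isLocalRing_locPrime mem_locPrime_of_mem)
open Summit.ResolutionOfSingularities.ResolutionOfSingularities.Theorems.NoZeno.SandwichCluster.Thread
  (toSubring_le_locPrime isLocalization_locPrime essFiniteType_blowupChart)
open Summit.ResolutionOfSingularities.ResolutionOfSingularities.Theorems.NoZeno.SplittingBase
  (locPrimeSubalgebra le_locPrimeSubalgebra)
open Summit.ResolutionOfSingularities.ResolutionOfSingularities.Theorems.SyzygyFlattening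
  (self_le_nrm isIntegrallyClosed_nrm stub_essFiniteType_nrm)
open Summit.ResolutionOfSingularities.ResolutionOfSingularities.Theorems.SurfaceTermination

namespace Summit.ResolutionOfSingularities.ResolutionOfSingularities.Theorems.NoZeno.ExcCount

variable {k K : Type} [Field k] [Field K] [Algebra k K]

/-- **(S1) THE CHART-RING SPELLING BRIDGE**: `k[T_P ∪ C·x⁻¹] = k[T_P ∪ I·x⁻¹]` for `I = (C)·T_P` the ideal of the germ spanned by `C ⊆ T_P`
and `x ∈ C` (one inclusion is `C ⊆ I`, the other is `ChartFibre.mul_inv_mem_of_mem_span`). [folklore] -/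
theorem adjoin_locPrime_chart_set_eq (T : Subalgebra k K) (P : Ideal ↥T) (hP : P.IsPrime) {C : Set K}
    (hCT : C ⊆ (T : Set K)) {x : K} (hxC : x ∈ C) :
    Algebra.adjoin k ((locPrime T P hP : Set K) ∪ {y : K | ∃ c ∈ C, y = c * x⁻¹}) =
      Algebra.adjoin k (((locPrimeSubalgebra T P hP : Subalgebra k K) : Set K) ∪
        {y : K | ∃ c : ↥(locPrimeSubalgebra T P hP),
          c ∈ Ideal.span {d : ↥(locPrimeSubalgebra T P hP) | (d : K) ∈ C} ∧
            y = (c : K) * ((⟨x, le_locPrimeSubalgebra T P hP (hCT hxC)⟩ : ↥(locPrimeSubalgebra T P hP)) : K)⁻¹}) := by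
  apply le_antisymm
  · refine Algebra.adjoin_le ?_
    rintro y (hy | ⟨c, hc, rfl⟩)
    · exact Algebra.subset_adjoin (Or.inl hy)
    · exact Algebra.subset_adjoin (Or.inr ⟨⟨c, le_locPrimeSubalgebra T P hP (hCT hc)⟩,
        Ideal.subset_span (show ((⟨c, _⟩ : ↥(locPrimeSubalgebra T P hP)) : K) ∈ C from hc), rfl⟩)
  · refine Algebra.adjoin_le ?_
    rintro y (hy | ⟨c, hc, rfl⟩)
    · exact Algebra.subset_adjoin (Or.inl hy)
    · exact ChartFibre.mul_inv_mem_of_mem_span (locPrimeSubalgebra T P hP)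
        {d : ↥(locPrimeSubalgebra T P hP) | (d : K) ∈ C} x
        (fun z hz => Algebra.subset_adjoin (Or.inl hz))
        (fun g hg => Algebra.subset_adjoin (Or.inr ⟨(g : K), hg, rfl⟩)) hc

/-- **THE SEAM-1 PACKAGE (slot 5 closer, literal `Sig.L1Core` binders).**  For the germ `D = T_P` (two-dimensional, rational, `Frac = K`),
the base ideal `I = (C)·D` (`√I = 𝔪`, sep-X¹-sandwiched), `x ∈ C` non-zero, the chart ring `B = k[D ∪ C·x⁻¹]`, a prime `𝔮` of `N = nrm B`
with `D′ = N_𝔮 ⊇ D` normal of dimension two — granting Lipman (1.2) and (12.1)(i) — there are: the minimal resolution `π : X → Spec D` with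
its node blow-up `ρ : X¹ → X` (`ρ ≫ π` a resolution), a set `C𝔮` of exceptional curves of `ρ ≫ π` (the curves over `𝔮`), a resolution
`ψ : W → Spec D′` of the NEW GERM and `gW : W → X¹` such that: `C𝔮` is WALK-CONNECTED in `incidenceGraph (ρ ≫ π)` when `D′` is singular
(Zariski), some exceptional curve of `ρ ≫ π` is NOT in `C𝔮` (`P ≠ ∅`, `P ∩ C𝔮 = ∅`), `gW` carries the exceptional curves of `ψ` injectively
into `C𝔮`, `gW` is a local isomorphism everywhere, the closures of the `C𝔮`-curves lie in `range gW`, and `gW ≫ ρ ≫ π = ψ ≫ Spec(D ⊆ D′)`.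
[cite: Lipman1969, Theorem (12.1) (i) (p. 220); Lipman1969, Section 10 (p. 212); StacksProject, Tag 03H0] -/
theorem exists_seam1Package (h12 : Lipman1969_1_2.{0}) (h121 : Lipman1969_12_1_i.{0})
    (T : Subalgebra k K) (P : Ideal ↥T) (hP : P.IsPrime)
    [Algebra.EssFiniteType k ↥T] [IsIntegrallyClosed ↥T] [IsFractionRing ↥T K]
    (hdim : ringKrullDim ↥(locPrime T P hP) = 2) (hrat : HasRationalSingularity ↥(locPrime T P hP))
    (C : Set K) (hCT : C ⊆ (T : Set K))
    (hrad : (Ideal.span {d : ↥(locPrime T P hP) | (d : K) ∈ C}).radical =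
      @maximalIdeal ↥(locPrime T P hP) _ (isLocalRing_locPrime T P hP))
    (hS : @IsSepX1Sandwiched ↥(locPrime T P hP) _ (isLocalRing_locPrime T P hP)
      (Ideal.span {d : ↥(locPrime T P hP) | (d : K) ∈ C}))
    (x : K) (hxC : x ∈ C) (hx0 : x ≠ 0)
    (B : Subalgebra k K) (hB : B = Algebra.adjoin k ((locPrime T P hP : Set K) ∪ {y : K | ∃ c ∈ C, y = c * x⁻¹}))
    (𝔮 : Ideal ↥(nrm B)) (h𝔮 : 𝔮.IsPrime) (D' : Subring K) (hD' : IsLocalRing ↥D')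
    (hEq : locPrime (nrm B) 𝔮 h𝔮 = D') (hDD' : (locPrime T P hP : Set K) ⊆ D')
    (hdim' : ringKrullDim ↥D' = 2) (hnorm' : IsIntegrallyClosed ↥D') :
    ∃ (X : Scheme.{0}) (π : X ⟶ Spec (.of ↥(locPrime T P hP))) (_ : IsMinimalResolution π)
      (X1 : Scheme.{0}) (_ : IsIntegral X1) (_ : IsLocallyNoetherian X1) (ρ : X1 ⟶ X)
      (_ : IsBlowup ρ (Scheme.IdealSheafData.vanishingIdeal ⟨closure (sepNodes π), isClosed_closure⟩))
      (_ : IsResolution (ρ ≫ π))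
      (C𝔮 : Set X1) (W : Scheme.{0}) (_ : IsIntegral W) (ψ : W ⟶ Spec (.of ↥D')) (_ : IsResolution ψ)
      (gW : W ⟶ X1),
      C𝔮 ⊆ excCurvePoints (ρ ≫ π) ∧
      (¬ IsRegularLocalRing ↥D' →
        ∀ a ∈ C𝔮, ∀ b ∈ C𝔮, ∃ p : (incidenceGraph (ρ ≫ π)).Walk a b, ∀ v ∈ p.support, v ∈ C𝔮) ∧
      (∃ η₀ ∈ excCurvePoints (ρ ≫ π), η₀ ∉ C𝔮) ∧
      (∀ y ∈ excCurvePoints ψ, gW.base y ∈ C𝔮) ∧ Set.InjOn gW.base (excCurvePoints ψ) ∧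
      (∀ w : W, IsIso (gW.stalkMap w)) ∧
      (∀ η ∈ C𝔮, closure ({η} : Set X1) ⊆ Set.range gW.base) ∧
      ∃ f : ↥(locPrime T P hP) →+* ↥D', (∀ d, ((f d : ↥D') : K) = (d : K)) ∧
        gW ≫ ρ ≫ π = ψ ≫ Spec.map (CommRingCat.ofHom f) := by
  -- (S2) the germ as a `k`-subalgebra `T'` (same carrier as `locPrime T P hP`), its instances, `I`, `x'`
  haveI : IsNoetherianRing ↥T := Algebra.EssFiniteType.isNoetherianRing k ↥T
  haveI : IsLocalRing ↥(locPrimeSubalgebra T P hP) := isLocalRing_locPrime T P hP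
  have hxT : x ∈ locPrimeSubalgebra T P hP := le_locPrimeSubalgebra T P hP (hCT hxC)
  have hxI : (⟨x, hxT⟩ : ↥(locPrimeSubalgebra T P hP)) ∈
      Ideal.span {d : ↥(locPrimeSubalgebra T P hP) | (d : K) ∈ C} :=
    Ideal.subset_span (show ((⟨x, hxT⟩ : ↥(locPrimeSubalgebra T P hP)) : K) ∈ C from hxC)
  have hx0' : ((⟨x, hxT⟩ : ↥(locPrimeSubalgebra T P hP)) : K) ≠ 0 := hx0
  have hdimT : ringKrullDim ↥(locPrimeSubalgebra T P hP) = 2 := hdim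
  have hradT : (Ideal.span {d : ↥(locPrimeSubalgebra T P hP) | (d : K) ∈ C}).radical =
      maximalIdeal ↥(locPrimeSubalgebra T P hP) := hrad
  have hST : IsSepX1Sandwiched ↥(locPrimeSubalgebra T P hP)
      (Ideal.span {d : ↥(locPrimeSubalgebra T P hP) | (d : K) ∈ C}) := hS
  have hratT : HasRationalSingularity ↥(locPrimeSubalgebra T P hP) := hrat
  -- (S1) the chart ring in the ideal spelling; `B` and `D'` become literal
  have hBB : B = Algebra.adjoin k (((locPrimeSubalgebra T P hP : Subalgebra k K) : Set K) ∪
      {y : K | ∃ c : ↥(locPrimeSubalgebra T P hP),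
        c ∈ Ideal.span {d : ↥(locPrimeSubalgebra T P hP) | (d : K) ∈ C} ∧
          y = (c : K) * ((⟨x, hxT⟩ : ↥(locPrimeSubalgebra T P hP)) : K)⁻¹}) :=
    hB.trans (adjoin_locPrime_chart_set_eq T P hP hCT hxC)
  subst hBB
  subst hEq
  -- (1β) the chart data of the sandwiched germ
  obtain ⟨X, π, hπmin, -, X1, hX1, ρ, hρ, hprin, hψ1, e, he, σB, hσB⟩ :=
    exists_chartData_of_isSepX1Sandwiched (locPrimeSubalgebra T P hP) hdimT _ hradT hxI hx0' hST
  haveI := hX1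
  haveI : IsProper (ρ ≫ π) := hψ1.isProper
  haveI : IsLocallyNoetherian X1 := LocallyOfFiniteType.isLocallyNoetherian (ρ ≫ π)
  -- `P ≠ ∅`
  have hI0 : Ideal.span {d : ↥(locPrimeSubalgebra T P hP) | (d : K) ∈ C} ≠ ⊥ := fun h => by
    apply hx0'
    have : (⟨x, hxT⟩ : ↥(locPrimeSubalgebra T P hP)) = 0 := by simpa [h] using hxI
    rw [this]; rfl
  obtain ⟨c, hc⟩ := exists_maximalIdeal_pow_le_of_radical_eq hradT
  have hIm : Ideal.span {d : ↥(locPrimeSubalgebra T P hP) | (d : K) ∈ C} ≤ maximalIdeal _ :=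
    hradT ▸ Ideal.le_radical
  obtain ⟨hJ, η₀, hη₀, hneg⟩ := exists_excCurveDegree_baseIdealDivisor_neg_of_hasRationalSingularity
    (locPrimeSubalgebra T P hP) (ρ ≫ π) h12 h121 hdimT hratT hψ1 hI0 hc hIm hprin
  -- the normalised chart ring is Noetherian (essentially of finite type over `k`)
  have hDB : locPrimeSubalgebra T P hP ≤ Algebra.adjoin k (((locPrimeSubalgebra T P hP : Subalgebra k K) : Set K) ∪
      {y : K | ∃ c : ↥(locPrimeSubalgebra T P hP),
        c ∈ Ideal.span {d : ↥(locPrimeSubalgebra T P hP) | (d : K) ∈ C} ∧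
          y = (c : K) * ((⟨x, hxT⟩ : ↥(locPrimeSubalgebra T P hP)) : K)⁻¹}) :=
    fun y hy => Algebra.subset_adjoin (Or.inl hy)
  haveI : Algebra.EssFiniteType k ↥(Algebra.adjoin k (((locPrimeSubalgebra T P hP : Subalgebra k K) : Set K) ∪
      {y : K | ∃ c : ↥(locPrimeSubalgebra T P hP),
        c ∈ Ideal.span {d : ↥(locPrimeSubalgebra T P hP) | (d : K) ∈ C} ∧
          y = (c : K) * ((⟨x, hxT⟩ : ↥(locPrimeSubalgebra T P hP)) : K)⁻¹})) :=
    essFiniteType_blowupChart T P hP C hCT x _ hB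
  haveI : IsFractionRing ↥(Algebra.adjoin k (((locPrimeSubalgebra T P hP : Subalgebra k K) : Set K) ∪
      {y : K | ∃ c : ↥(locPrimeSubalgebra T P hP),
        c ∈ Ideal.span {d : ↥(locPrimeSubalgebra T P hP) | (d : K) ∈ C} ∧
          y = (c : K) * ((⟨x, hxT⟩ : ↥(locPrimeSubalgebra T P hP)) : K)⁻¹})) K :=
    isFractionRing_subalgebra_of_le _ _ hDB
  haveI : Algebra.EssFiniteType k ↥(nrm (Algebra.adjoin k (((locPrimeSubalgebra T P hP : Subalgebra k K) : Set K) ∪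
      {y : K | ∃ c : ↥(locPrimeSubalgebra T P hP),
        c ∈ Ideal.span {d : ↥(locPrimeSubalgebra T P hP) | (d : K) ∈ C} ∧
          y = (c : K) * ((⟨x, hxT⟩ : ↥(locPrimeSubalgebra T P hP)) : K)⁻¹}))) :=
    stub_essFiniteType_nrm k K _ inferInstance inferInstance
  haveI : IsNoetherianRing ↥(nrm (Algebra.adjoin k (((locPrimeSubalgebra T P hP : Subalgebra k K) : Set K) ∪
      {y : K | ∃ c : ↥(locPrimeSubalgebra T P hP),
        c ∈ Ideal.span {d : ↥(locPrimeSubalgebra T P hP) | (d : K) ∈ C} ∧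
          y = (c : K) * ((⟨x, hxT⟩ : ↥(locPrimeSubalgebra T P hP)) : K)⁻¹}))) :=
    Algebra.EssFiniteType.isNoetherianRing k _
  -- (G4) `𝔮` is maximal over `𝔪`
  obtain ⟨h𝔮max, h𝔪⟩ := ChartFibre.isMaximal_and_comap_eq_chart_ideal (locPrimeSubalgebra T P hP) hdimT
    (IsNoetherian.noetherian _) ⟨x, hxT⟩ (ChartResolution.le_nrm_adjoin (locPrimeSubalgebra T P hP)) 𝔮 h𝔮 hdim'
  haveI := h𝔮max
  -- the new germ `D' = N_𝔮` as an `N`-algebra, a localisation at `𝔮`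
  letI : Algebra ↥(nrm (Algebra.adjoin k (((locPrimeSubalgebra T P hP : Subalgebra k K) : Set K) ∪
      {y : K | ∃ c : ↥(locPrimeSubalgebra T P hP),
        c ∈ Ideal.span {d : ↥(locPrimeSubalgebra T P hP) | (d : K) ∈ C} ∧
          y = (c : K) * ((⟨x, hxT⟩ : ↥(locPrimeSubalgebra T P hP)) : K)⁻¹}))) ↥(locPrime (nrm _) 𝔮 h𝔮) :=
    (Subring.inclusion (toSubring_le_locPrime (nrm _) 𝔮 h𝔮)).toAlgebra
  haveI := isLocalization_locPrime (nrm (Algebra.adjoin k (((locPrimeSubalgebra T P hP : Subalgebra k K) : Set K) ∪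
      {y : K | ∃ c : ↥(locPrimeSubalgebra T P hP),
        c ∈ Ideal.span {d : ↥(locPrimeSubalgebra T P hP) | (d : K) ∈ C} ∧
          y = (c : K) * ((⟨x, hxT⟩ : ↥(locPrimeSubalgebra T P hP)) : K)⁻¹}))) 𝔮 h𝔮
  haveI := hD'
  haveI := hnorm'
  haveI : IsNoetherianRing ↥(locPrime (nrm (Algebra.adjoin k (((locPrimeSubalgebra T P hP : Subalgebra k K) : Set K) ∪
      {y : K | ∃ c : ↥(locPrimeSubalgebra T P hP),
        c ∈ Ideal.span {d : ↥(locPrimeSubalgebra T P hP) | (d : K) ∈ C} ∧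
          y = (c : K) * ((⟨x, hxT⟩ : ↥(locPrimeSubalgebra T P hP)) : K)⁻¹}))) 𝔮 h𝔮) :=
    IsLocalization.isNoetherianRing 𝔮.primeCompl _ inferInstance
  -- (1α) the chart-germ resolution package
  obtain ⟨hne, σ, -, hσc, hσres, hψ', -⟩ := exists_chartGermResolution (locPrimeSubalgebra T P hP) (ρ ≫ π) e he σB hσB
    hxI hψ1 hx0' 𝔮 ↥(locPrime (nrm _) 𝔮 h𝔮)
  haveI : IsProper σ := hσres.isProper
  haveI : IsPreimmersion (Spec.map (CommRingCat.ofHom (algebraMap ↥(nrm (Algebra.adjoin k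
      (((locPrimeSubalgebra T P hP : Subalgebra k K) : Set K) ∪ {y : K | ∃ c : ↥(locPrimeSubalgebra T P hP),
        c ∈ Ideal.span {d : ↥(locPrimeSubalgebra T P hP) | (d : K) ∈ C} ∧
          y = (c : K) * ((⟨x, hxT⟩ : ↥(locPrimeSubalgebra T P hP)) : K)⁻¹}))) ↥(locPrime (nrm _) 𝔮 h𝔮)))) :=
    IsPreimmersion.of_isLocalization 𝔮.primeCompl
  haveI : Flat (Spec.map (CommRingCat.ofHom (algebraMap ↥(nrm (Algebra.adjoin k
      (((locPrimeSubalgebra T P hP : Subalgebra k K) : Set K) ∪ {y : K | ∃ c : ↥(locPrimeSubalgebra T P hP),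
        c ∈ Ideal.span {d : ↥(locPrimeSubalgebra T P hP) | (d : K) ∈ C} ∧
          y = (c : K) * ((⟨x, hxT⟩ : ↥(locPrimeSubalgebra T P hP)) : K)⁻¹}))) ↥(locPrime (nrm _) 𝔮 h𝔮)))) := by
    rw [Flat.SpecMap_iff, CommRingCat.hom_ofHom, RingHom.flat_algebraMap_iff]
    exact IsLocalization.flat _ 𝔮.primeCompl
  -- the outputs
  refine ⟨X, π, hπmin, X1, hX1, inferInstance, ρ, hρ, hψ1,
    (σB ⁻¹ᵁ (affineBlowup.chartOpen (⟨x, hxT⟩ : ↥(locPrimeSubalgebra T P hP)) hxI).1).ι.base ''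
      {z | σ.base z = ⟨𝔮, inferInstance⟩ ∧ Order.height z = 1},
    pullback σ (Spec.map (CommRingCat.ofHom (algebraMap _ ↥(locPrime (nrm _) 𝔮 h𝔮)))), hψ'.isIntegral_source,
    pullback.snd σ (Spec.map (CommRingCat.ofHom (algebraMap _ ↥(locPrime (nrm _) 𝔮 h𝔮)))), hψ',
    pullback.fst σ (Spec.map (CommRingCat.ofHom (algebraMap _ ↥(locPrime (nrm _) 𝔮 h𝔮)))) ≫
      (σB ⁻¹ᵁ (affineBlowup.chartOpen (⟨x, hxT⟩ : ↥(locPrimeSubalgebra T P hP)) hxI).1).ι,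
    ?_, ?_, ?_, ?_, ?_, ?_, ?_, ?_⟩
  · -- `C𝔮 ⊆ excCurvePoints (ρ ≫ π)`
    exact image_chartFibreCurves_subset_excCurvePoints (locPrimeSubalgebra T P hP) (ρ ≫ π) _ _ σ hσc 𝔮 h𝔪
  · -- walk-connected when `D'` is singular
    intro hsing
    exact walkConnected_chartFibreCurves (locPrimeSubalgebra T P hP) (ρ ≫ π) _ _ σ hσc 𝔮 h𝔪 _ hdimT hψ1 hdim' hψ'
      hsing
  · -- a curve outside `C𝔮`: the `Z`-negative one
    refine ⟨η₀, hη₀, fun hC => ?_⟩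
    exact (disjoint_baseIdealNeg_chartFibreCurves (locPrimeSubalgebra T P hP) (ρ ≫ π) e he σB hσB hxI σ hσc 𝔮 h𝔪
      hx0' hJ).le_bot ⟨⟨hη₀, hneg⟩, hC⟩
  · -- `gW` carries the curves of `ψ` into `C𝔮`
    intro y hy
    exact ι_fst_mem_chartFibreCurves (T := locPrimeSubalgebra T P hP) (U := _) (σ := σ) (𝔮 := 𝔮) (N' := _) hy
  · -- injectively
    exact (injective_ι_fst (T := locPrimeSubalgebra T P hP) (U := _) (σ := σ) (𝔮 := 𝔮) (N' := _)).injOn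
  · -- `gW` is a local isomorphism
    intro w
    exact isIso_stalkMap_of_flat_of_isPreimmersion _ w
  · -- closures of the `C𝔮`-curves lie in `range gW`
    rintro _ ⟨z, ⟨hz, -⟩, rfl⟩ y hy
    obtain ⟨w, hw, rfl⟩ := ChartFibre.exists_eq_ι_of_mem_closure_chart_nrm (locPrimeSubalgebra T P hP) _ (ρ ≫ π)
      (IsNoetherian.noetherian _) _ σ hσc ⟨𝔮, inferInstance⟩
      (ChartFibre.comap_inclusion_isMaximal_of_eq _ _ 𝔮 h𝔪) z hz hy
    have hwr : w ∈ Set.range (pullback.fst σ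
        (Spec.map (CommRingCat.ofHom (algebraMap _ ↥(locPrime (nrm _) 𝔮 h𝔮))))).base := by
      rw [Scheme.Pullback.range_fst]
      exact ⟨closedPoint _, by rw [specMap_localization_closedPoint 𝔮]; exact hw.symm⟩
    obtain ⟨ζ, rfl⟩ := hwr
    exact ⟨ζ, rfl⟩
  · -- the square over `Spec D ← Spec D'`
    refine ⟨(algebraMap _ ↥(locPrime (nrm _) 𝔮 h𝔮)).comp
      (Subalgebra.inclusion (ChartResolution.le_nrm_adjoin (locPrimeSubalgebra T P hP)
        (I := Ideal.span {d : ↥(locPrimeSubalgebra T P hP) | (d : K) ∈ C}) (x := ⟨x, hxT⟩))).toRingHom,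
      fun d => rfl, ?_⟩
    rw [Category.assoc]
    refine (congrArg (fun φ => pullback.fst σ (Spec.map (CommRingCat.ofHom
      (algebraMap _ ↥(locPrime (nrm _) 𝔮 h𝔮)))) ≫ φ) hσc).trans ?_
    dsimp only
    rw [← Category.assoc, pullback.condition, Category.assoc, ← Spec.map_comp, ← CommRingCat.ofHom_comp]
    rfl

end Summit.ResolutionOfSingularities.ResolutionOfSingularities.Theorems.NoZeno.ExcCount

end
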